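import Literature.AlgebraicGeometry.AbelianSchemes.GraphPointLevelZero
import Literature.AlgebraicGeometry.AbelianSchemes.AbelianSchemeFibreFieldChange
import Literature.AlgebraicGeometry.AbelianVarieties.RankOneIsoDescendsFieldExtension
import Literature.AlgebraicGeometry.Morphisms.GaloisFixedPointDescends
import Mathlib.FieldTheory.IsAlgClosed.AlgebraicClosure
import HarnessLib

/-!
# (Mc) N3′ step S-f — the level-0 graph point DESCENDS from `κ(t)^alg` to `κ(t)`: for EVERY point `t ∈ T′` there is
# `y₀ : Spec κ(t) → Â′` over `S′` with `(1 × y₀)^*𝒫′ ≅ (1 × ι_t)^*ℒ` ([MumfordAV1970] §13, proof of the Thm., level 0; Galois descent)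

Layer `Literature/AlgebraicGeometry/AbelianSchemes`, namespace `Literature.AlgebraicGeometry.AbelianSchemes.AbelianSchemeOver`.  THEOREMS ONLY (no definition,
no named fact, no instance, no notation).  Setting = ★ `GraphPointLevelZero` (the (Mc) letters' socket currency: `A′/S′`, rank-one `L′` with ample
geometric fibre classes `hΘ′`, `π : A′ → Â′ = hat`, rank-one `𝒫′ = P` on `A′ ×_{S′} Â′` with `(1 × π)^*𝒫′ ≅ Λ(L′)`, a base `T′ → S′`, a rigidified `ℒ`
on `A′ ×_{S′} T′` fibrewise in `Pic⁰`) PLUS the uniqueness of graph points over geometric points (`hinj`, the (Mc) letter N2b′).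

* §1 `nonempty_graphIso_comp_of_graphIso` — a TWIST of a graph point by an endomorphism `σ̄` of the base point fixing `x̄` is a graph point
  (`(1 × σ̄)^*` of the graph isomorphism).
* §2 **`exists_graphPoint_residueField`** — for every `t ∈ T′` (no closedness, no `[JacobsonSpace]`) with `char κ(t) = 0` there is
  `y₀ : Spec κ(t) → Â′` over `S′` with `(1_{A′} × y₀)^*𝒫′ ≅ (1_{A′} × x̄₀)^*ℒ` on `A′_{κ(t)}` (`x̄₀ = ι_t : Spec κ(t) → T′`).  Proof: `Ω := κ(t)^alg`;
  the level-0 point `y : Spec Ω → Â′` (★ `exists_graphPoint_of_fibrewisePicZero_of_eq`, [MumfordAV1970] §8 Thm. 1 over `Ω`) is `Gal(Ω∕κ(t))`-fixed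
  (§1 + `hinj`), hence defined over `κ(t)` (★ `Morphisms.exists_specMap_algebraMap_comp_eq_of_forall_algEquiv`, `Ω^{Gal} = κ(t)` as `char = 0`); and
  the two rank-one modules on `A′_{κ(t)}` become isomorphic on `A′_Ω` (★ `fibreFieldChangeIso`), hence are isomorphic (★
  `nonempty_iso_of_nonempty_iso_pullback_baseChangeFst`, «`Pic(X) ↪ Pic(X_Ω)`»).

Purpose (cell `hodgecm-mathlib`, F-3 (Mc) spine, N3′ = `stub_McN3`, step S-f of the (R-a′) slim relative tower; B-plan1 (g19) 20:24:23Z): the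
`n = 0` case of the thickening-lift induction at an ARBITRARY point `t`, up to the composer's frame `Spec (𝒪_{T′,t}⧸𝔪) ≅ Spec κ(t)`.  HC_CM is proved
only modulo the 7 printed citations until rung 0 closes; nothing here bears on a summit statement.

## References
* [MumfordAV1970] D. Mumford, *Abelian Varieties* (1970), §8 Theorem 1 (p. 77); §13 (proof of the Thm., pp. 125–130).
* [MilneAV2008] J. S. Milne, *Abelian Varieties* (2008), I §8 (pp. 36–37).
* [GortzWedhorn2020] U. Görtz, T. Wedhorn, *Algebraic Geometry I*, 2nd ed. (2020), Prop. 5.4 (p. 123), Section (4.7) (pp. 107–108).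
* [GortzWedhorn2023] U. Görtz, T. Wedhorn, *Algebraic Geometry II* (2023), Thm. 24.66 (1) (p. 405).
-/

set_option autoImplicit false

noncomputable section

open CategoryTheory CategoryTheory.Limits AlgebraicGeometry MonoidalCategory CartesianMonoidalCategory

-- `(A.fibre s).toAbelianVariety.X.left = pullback A.X.hom s = (A.X ⊗ Over.mk s).left` hold by `rfl` only.
set_option backward.isDefEq.respectTransparency false

namespace Literature.AlgebraicGeometry.AbelianSchemes

namespace AbelianSchemeOver

open Literature.AlgebraicGeometry.Motives Literature.AlgebraicGeometry.AbelianVarieties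
  Literature.AlgebraicGeometry.Modules Literature.AlgebraicGeometry.Morphisms
open scoped MonObj

variable {S' : Scheme.{0}} (A' : AbelianSchemeOver S')

/-! ## §1 Twists of graph points by endomorphisms of the base point -/

/-- Plumbing: `(1 × (u ≫ v))^* = (1 × u)^* (1 × v)^*` on modules. [cite: GortzWedhorn2020, Section (4.7) (pp. 107–108)] -/
theorem whiskerLeft_comp_left {U V W : Over S'} (u : U ⟶ V) (v : V ⟶ W) :
    (A'.X ◁ (u ≫ v)).left = (A'.X ◁ u).left ≫ (A'.X ◁ v).left := by
  rw [MonoidalCategory.whiskerLeft_comp, Over.comp_left]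

/-- **A twist of a graph point is a graph point**: if `(1 × y)^*𝒫′ ≅ (1 × x̄)^*ℒ` over the base point `Spec Ω → S′` and `σ̄` is an endomorphism of
`Spec Ω` over `S′` with `σ̄ ≫ x̄ = x̄`, then `(1 × (σ̄ ≫ y))^*𝒫′ ≅ (1 × x̄)^*ℒ` (apply `(1 × σ̄)^*`).
[cite: MumfordAV1970, §13 (proof of the Thm., pp. 125–130)] [cite: MilneAV2008, I §8 (pp. 36–37)] -/
theorem nonempty_graphIso_comp_of_graphIso (hat : AbelianSchemeOver S') (P : (A'.prodLeft hat).Modules) {T' : Over S'}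
    (ℒ : A'.RigidifiedLineBundle T'.hom) {Ω : Type} [Field Ω] {s : Spec (.of Ω) ⟶ S'} (x : Over.mk s ⟶ T') (y : Over.mk s ⟶ hat.X)
    (σ : Over.mk s ⟶ Over.mk s) (hσ : σ ≫ x = x)
    (e : (Scheme.Modules.pullback (A'.baseChangeToProd hat s y.left (Over.w y))).obj P ≅
      (Scheme.Modules.pullback (A'.X ◁ x).left).obj ℒ.L) :
    Nonempty ((Scheme.Modules.pullback (A'.baseChangeToProd hat s (σ ≫ y).left (Over.w (σ ≫ y)))).obj P ≅
      (Scheme.Modules.pullback (A'.X ◁ x).left).obj ℒ.L) := by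
  have hb : A'.baseChangeToProd hat s y.left (Over.w y) = (A'.X ◁ y).left := A'.baseChangeToProd_eq_whiskerLeft_left hat y
  have hbσ : A'.baseChangeToProd hat s (σ ≫ y).left (Over.w (σ ≫ y)) = (A'.X ◁ σ).left ≫ (A'.X ◁ y).left :=
    (A'.baseChangeToProd_eq_whiskerLeft_left hat (σ ≫ y)).trans (A'.whiskerLeft_comp_left σ y)
  have hx : (A'.X ◁ σ).left ≫ (A'.X ◁ x).left = (A'.X ◁ x).left := by rw [← A'.whiskerLeft_comp_left σ x, hσ]
  let e' : (Scheme.Modules.pullback (A'.X ◁ y).left).obj P ≅ (Scheme.Modules.pullback (A'.X ◁ x).left).obj ℒ.L :=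
    (Scheme.Modules.pullbackCongr hb.symm).app P ≪≫ e
  exact ⟨(Scheme.Modules.pullbackCongr hbσ).app P ≪≫
    ((Scheme.Modules.pullbackComp (A'.X ◁ σ).left (A'.X ◁ y).left).app P).symm ≪≫
    (Scheme.Modules.pullback (A'.X ◁ σ).left).mapIso e' ≪≫
    (Scheme.Modules.pullbackComp (A'.X ◁ σ).left (A'.X ◁ x).left).app ℒ.L ≪≫
    (Scheme.Modules.pullbackCongr hx).app ℒ.L⟩

/-! ## §2 The graph point over the residue field of an arbitrary point -/

/-- **N3′ S-f — THE LEVEL-0 GRAPH POINT OVER `κ(t)`, for EVERY `t ∈ T′`.**  In the setting of ★ `exists_graphPoint_of_fibrewisePicZero` (socket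
currency) assume moreover that graph points over geometric points are UNIQUE (`hinj`, the (Mc) letter N2b′) and `char κ(t) = 0`.  Then there is
`y₀ : Spec κ(t) → Â′` over `S′` with `(1_{A′} × y₀)^*𝒫′ ≅ (1_{A′} × ι_t)^*ℒ` on `A′_{κ(t)}`, `ι_t : Spec κ(t) → T′` the canonical point — by Galois
descent of the level-0 point over `κ(t)^alg` (§1 + `hinj` ⇒ `Gal`-fixed ⇒ ★ `exists_specMap_algebraMap_comp_eq_of_forall_algEquiv`) and of the
isomorphism (★ `nonempty_iso_of_nonempty_iso_pullback_baseChangeFst` through ★ `fibreFieldChangeIso`).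
[cite: MumfordAV1970, §8 Theorem 1 (p. 77) and §13 (proof of the Thm., pp. 125–130)] [cite: GortzWedhorn2020, Prop. 5.4 (p. 123)]
[cite: GortzWedhorn2023, Thm. 24.66 (1) (p. 405)] -/
theorem exists_graphPoint_residueField {L' : A'.left.Modules} (hL' : HasRank L' 1)
    (hΘ' : ∀ ⦃Ω : Type⦄ [Field Ω] [IsAlgClosed Ω] (s : Spec (.of Ω) ⟶ S'),
      ∃ Θ : CartierDivisor (A'.fibre s).toAbelianVariety.X.left, Θ.IsAmple ∧
        CechPic.pullback (X := (A'.fibre s).toAbelianVariety.X.left) (pullback.fst A'.X.hom s)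
          (detClass (HasRank.isFiniteLocallyFree' hL')) = Θ.cechClass)
    (hat : AbelianSchemeOver S') (π : A'.X ⟶ hat.X) (P : (A'.prodLeft hat).Modules) (hP1 : HasRank P 1)
    (hsock : Nonempty ((Scheme.Modules.pullback (A'.X ◁ π).left).obj P ≅ A'.mumfordBundle L'))
    {T' : Over S'} (ℒ : A'.RigidifiedLineBundle T'.hom) (hℒ : ℒ.FibrewisePicZero)
    (hinj : ∀ ⦃Ω : Type⦄ [Field Ω] [IsAlgClosed Ω] (s : Spec (.of Ω) ⟶ S') (x : Over.mk s ⟶ T') (y y' : Over.mk s ⟶ hat.X),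
      Nonempty ((Scheme.Modules.pullback (A'.baseChangeToProd hat s y.left (Over.w y))).obj P ≅
        (Scheme.Modules.pullback (A'.X ◁ x).left).obj ℒ.L) →
      Nonempty ((Scheme.Modules.pullback (A'.baseChangeToProd hat s y'.left (Over.w y'))).obj P ≅
        (Scheme.Modules.pullback (A'.X ◁ x).left).obj ℒ.L) → y = y')
    (t : T'.left) [CharZero (T'.left.residueField t)] :
    ∃ y₀ : Over.mk (T'.left.fromSpecResidueField t ≫ T'.hom) ⟶ hat.X,
      Nonempty ((Scheme.Modules.pullback (A'.baseChangeToProd hat (T'.left.fromSpecResidueField t ≫ T'.hom) y₀.left (Over.w y₀))).obj P ≅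
        (Scheme.Modules.pullback (A'.X ◁ (Over.homMk (T'.left.fromSpecResidueField t) rfl :
          Over.mk (T'.left.fromSpecResidueField t ≫ T'.hom) ⟶ T')).left).obj ℒ.L) := by
  classical
  -- the residue field `κ`, its algebraic closure `Ω`, the points `x₀ : Spec κ → T′`, `xΩ : Spec Ω → T′`
  let κ : Type := T'.left.residueField t
  let Ω : Type := AlgebraicClosure κ
  let emb : κ →+* Ω := algebraMap κ Ω
  haveI : CharZero Ω := charZero_of_injective_algebraMap emb.injective
  haveI : IsGalois κ Ω := IsAlgClosure.isGalois κ Ω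
  let x₀ : Spec (.of κ) ⟶ T'.left := T'.left.fromSpecResidueField t
  let s₀ : Spec (.of κ) ⟶ S' := x₀ ≫ T'.hom
  let xΩ : Spec (.of Ω) ⟶ T'.left := Spec.map (CommRingCat.ofHom emb) ≫ x₀
  let sΩ : Spec (.of Ω) ⟶ S' := Spec.map (CommRingCat.ofHom emb) ≫ s₀
  have hsΩ : xΩ ≫ T'.hom = sΩ := Category.assoc _ _ _
  let xq₀ : Over.mk s₀ ⟶ T' := Over.homMk x₀ rfl
  let xqΩ : Over.mk sΩ ⟶ T' := Over.homMk xΩ hsΩ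
  let jq : Over.mk sΩ ⟶ Over.mk s₀ := Over.homMk (Spec.map (CommRingCat.ofHom emb)) rfl
  have hjqx : jq ≫ xq₀ = xqΩ := by ext; rfl
  -- level 0 over `Ω`
  obtain ⟨y, ⟨eΩ⟩⟩ := A'.exists_graphPoint_of_fibrewisePicZero_of_eq hL' hΘ' hat π P hP1 hsock ℒ hℒ sΩ xΩ hsΩ
  -- (b) `y` is `Gal(Ω∕κ)`-fixed
  have hfix : ∀ σ : Ω ≃ₐ[κ] Ω, Spec.map (CommRingCat.ofHom σ.toAlgHom.toRingHom) ≫ y.left = y.left := by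
    intro σ
    have hσemb : Spec.map (CommRingCat.ofHom σ.toAlgHom.toRingHom) ≫ Spec.map (CommRingCat.ofHom emb) =
        Spec.map (CommRingCat.ofHom emb) := by
      rw [← Spec.map_comp]
      congr 1
      ext r
      exact σ.commutes r
    let σq : Over.mk sΩ ⟶ Over.mk sΩ := Over.homMk (Spec.map (CommRingCat.ofHom σ.toAlgHom.toRingHom)) (by
      change Spec.map _ ≫ Spec.map _ ≫ s₀ = Spec.map _ ≫ s₀
      rw [← Category.assoc, hσemb])
    have hσx : σq ≫ xqΩ = xqΩ := by
      ext
      change Spec.map _ ≫ Spec.map _ ≫ x₀ = Spec.map _ ≫ x₀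
      rw [← Category.assoc, hσemb]
    have hy' := A'.nonempty_graphIso_comp_of_graphIso hat P ℒ xqΩ y σq hσx eΩ
    have hyy := hinj sΩ xqΩ y (σq ≫ y) ⟨eΩ⟩ hy'
    have h2 : (σq ≫ y).left = y.left := congrArg (fun k => CommaMorphism.left k) hyy.symm
    exact h2
  -- (c) `y` descends to `y₀ : Spec κ → Â′` over `S′`
  obtain ⟨y₀', hy₀'⟩ := exists_specMap_algebraMap_comp_eq_of_forall_algEquiv y.left hfix
  have hw : y₀' ≫ hat.X.hom = s₀ := by
    apply eq_of_specMap_comp_eq emb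
    rw [← Category.assoc, hy₀']
    exact Over.w y
  let y₀ : Over.mk s₀ ⟶ hat.X := Over.homMk y₀' hw
  have hjqy : jq ≫ y₀ = y := by ext; exact hy₀'
  refine ⟨y₀, ?_⟩
  -- (d) the graph isomorphism descends: the fibre `X₀ = A′_{κ(t)}` and its base change to `Ω`
  let X₀ : AbelianVariety κ := (A'.fibre s₀).toAbelianVariety
  let πΩ : (X₀.baseChange Ω).X.left ⟶ X₀.X.left := pullback.fst X₀.X.hom (AbelianVariety.bcSpec κ Ω)
  have hπΩ : πΩ = pullback.fst X₀.X.hom (AbelianVariety.bcSpec κ Ω) := rfl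
  haveI : IsDominant πΩ := by
    change IsDominant (baseChangeHomFst (algebraMap κ Ω) X₀.X)
    exact AbelianVariety.isDominant_baseChangeHomFst_along (algebraMap κ Ω) X₀
  let e := A'.fibreFieldChangeIso emb s₀
  -- `πΩ = e ≫ (1 × jq)`
  have hwE : AbelianVariety.Hom.toSchemeHom e.hom ≫ (A'.fibre (specAlong emb ≫ s₀)).toAbelianVariety.X.hom =
      (X₀.baseChangeAlong emb).X.hom := Over.w e.hom.hom.hom.hom
  have hπ : πΩ = AbelianVariety.Hom.toSchemeHom e.hom ≫ (A'.X ◁ jq).left := by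
    apply pullback.hom_ext
    · rw [Category.assoc]
      exact (A'.fibreFieldChangeIso_hom_toSchemeHom_fst emb s₀).symm.trans
        (congrArg (fun k => AbelianVariety.Hom.toSchemeHom e.hom ≫ k) (Over.whiskerLeft_left_fst (R := A'.X) jq).symm)
    · rw [Category.assoc]
      calc πΩ ≫ pullback.snd A'.X.hom s₀
          = pullback.snd X₀.X.hom (AbelianVariety.bcSpec κ Ω) ≫ AbelianVariety.bcSpec κ Ω := pullback.condition
        _ = (AbelianVariety.Hom.toSchemeHom e.hom ≫ (A'.fibre (specAlong emb ≫ s₀)).toAbelianVariety.X.hom) ≫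
              Spec.map (CommRingCat.ofHom emb) := by rw [hwE]; rfl
        _ = AbelianVariety.Hom.toSchemeHom e.hom ≫ pullback.snd A'.X.hom sΩ ≫ jq.left := by rw [Category.assoc]; rfl
        _ = AbelianVariety.Hom.toSchemeHom e.hom ≫ (A'.X ◁ jq).left ≫ pullback.snd A'.X.hom s₀ :=
              congrArg (fun k => AbelianVariety.Hom.toSchemeHom e.hom ≫ k) (Over.whiskerLeft_left_snd (R := A'.X) jq).symm
  -- the two rank-one modules on `X₀` and their pull-backs to `X₀ ⊗ Ω`
  have hb₀ : A'.baseChangeToProd hat s₀ y₀.left (Over.w y₀) = (A'.X ◁ y₀).left := A'.baseChangeToProd_eq_whiskerLeft_left hat y₀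
  have hbΩ : A'.baseChangeToProd hat sΩ y.left (Over.w y) = (A'.X ◁ y).left := A'.baseChangeToProd_eq_whiskerLeft_left hat y
  have hM₀ : HasRank ((Scheme.Modules.pullback (A'.X ◁ y₀).left).obj P) 1 := hasRank_pullback _ hP1
  have hN₀ : HasRank ((Scheme.Modules.pullback (A'.X ◁ xq₀).left).obj ℒ.L) 1 := hasRank_pullback _ ℒ.hasRank_one
  have hy_comp : (A'.X ◁ jq).left ≫ (A'.X ◁ y₀).left = (A'.X ◁ y).left := by rw [← A'.whiskerLeft_comp_left, hjqy]
  have hx_comp : (A'.X ◁ jq).left ≫ (A'.X ◁ xq₀).left = (A'.X ◁ xqΩ).left := by rw [← A'.whiskerLeft_comp_left, hjqx]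
  let isoM : (Scheme.Modules.pullback πΩ).obj ((Scheme.Modules.pullback (A'.X ◁ y₀).left).obj P) ≅
      (Scheme.Modules.pullback (AbelianVariety.Hom.toSchemeHom e.hom)).obj ((Scheme.Modules.pullback (A'.X ◁ y).left).obj P) :=
    (Scheme.Modules.pullbackCongr hπ).app _ ≪≫
      ((Scheme.Modules.pullbackComp (AbelianVariety.Hom.toSchemeHom e.hom) (A'.X ◁ jq).left).app _).symm ≪≫
      (Scheme.Modules.pullback (AbelianVariety.Hom.toSchemeHom e.hom)).mapIso
        ((Scheme.Modules.pullbackComp (A'.X ◁ jq).left (A'.X ◁ y₀).left).app P ≪≫ (Scheme.Modules.pullbackCongr hy_comp).app P)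
  let isoN : (Scheme.Modules.pullback πΩ).obj ((Scheme.Modules.pullback (A'.X ◁ xq₀).left).obj ℒ.L) ≅
      (Scheme.Modules.pullback (AbelianVariety.Hom.toSchemeHom e.hom)).obj ((Scheme.Modules.pullback (A'.X ◁ xqΩ).left).obj ℒ.L) :=
    (Scheme.Modules.pullbackCongr hπ).app _ ≪≫
      ((Scheme.Modules.pullbackComp (AbelianVariety.Hom.toSchemeHom e.hom) (A'.X ◁ jq).left).app _).symm ≪≫
      (Scheme.Modules.pullback (AbelianVariety.Hom.toSchemeHom e.hom)).mapIso
        ((Scheme.Modules.pullbackComp (A'.X ◁ jq).left (A'.X ◁ xq₀).left).app ℒ.L ≪≫ (Scheme.Modules.pullbackCongr hx_comp).app ℒ.L)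
  let eΩ' : (Scheme.Modules.pullback (A'.X ◁ y).left).obj P ≅ (Scheme.Modules.pullback (A'.X ◁ xqΩ).left).obj ℒ.L :=
    (Scheme.Modules.pullbackCongr hbΩ.symm).app P ≪≫ eΩ
  have hdesc : Nonempty ((Scheme.Modules.pullback (A'.X ◁ y₀).left).obj P ≅ (Scheme.Modules.pullback (A'.X ◁ xq₀).left).obj ℒ.L) :=
    nonempty_iso_of_nonempty_iso_pullback_baseChangeFst Ω X₀ πΩ hπΩ hM₀ hN₀
      ⟨isoM ≪≫ (Scheme.Modules.pullback (AbelianVariety.Hom.toSchemeHom e.hom)).mapIso eΩ' ≪≫ isoN.symm⟩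
  obtain ⟨e₀⟩ := hdesc
  exact ⟨(Scheme.Modules.pullbackCongr hb₀).app P ≪≫ e₀⟩

end AbelianSchemeOver

end Literature.AlgebraicGeometry.AbelianSchemes

end
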